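import Summits.MatrixMultiplication.MatrixMultiplication.Theorems.GradedPricing.Negative.LoadBearing
import Summits.MatrixMultiplication.MatrixMultiplication.Theorems.GradedPricing.Negative.LeftInvariance
import Literature.RepresentationTheory.FiniteGroups.WedderburnBlocks
import Literature.Computability.AlgebraicComplexity.BCGPUInfiniteGroups

/-!
# `GradedPricing`, line `fourier-support-repfun`: the stubs' hypotheses are load-bearing
# (negative-side support, drefute seat)

Crux `stmt-MatrixMultiplication-7611` (`…Theses.LevelGradedCohnUmans.GradedPricing`), picked line
`fourier-support-repfun` (skeleton `Cruxes/GradedPricing/Lines/fourier-support-repfun.lean`,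
sha `f1ee29686f19`), registered stubs `stub_support` (Fourier-support lemma) and `stub_expansion`
(Fourier expansion at `1` onto the support).  Both stubs are TRUE (kernel-proved; `stub_support`
landed as `Theorems/LevelGradedCohnUmansGradedPricingStubSupport.lean`).  This file records, as
kernel-checked theorems, that their hypotheses cannot be dropped or weakened one-sidedly — the
stub-level sharpening of `gradedPricing_false_without_biInv` / `gradedPricing_false_with_leftInv_only`:

* `stubSupport_false_without_biInv` — `stub_support` with the bi-invariance hypothesis on `J`
  DROPPED is false.  Witness `G = Z/2`, any Wedderburn isomorphism `φ`, `J = ℂ·δ_g` (`g ≠ 1`),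
  `f = δ_g`: `f̌ ≠ 0`, so some Fourier coefficient `φ(f̌)ᵢ ≠ 0`, but no irreducible character lies
  in `ℂ·δ_g` (`irrChars_inter_span_single`).
* `stubSupport_false_with_leftInv_only` — `stub_support` with bi-invariance (`f ↦ f(a·b)`)
  weakened to LEFT-invariance (`f ↦ f(a·)`) is false.  Witness `G = S₃`, any `φ`, `J = J_col`
  (column space of the 2-dimensional irrep, `leftInvariant_Jcol`), `f = f₁ ≠ 0`: some `φ(f̌₁)ᵢ ≠ 0`,
  but `Irr(S₃) ∩ J_col = ∅` (`irrChars_inter_Jcol`).  (Right-invariance alone fails symmetrically,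
  via `g ↦ g⁻¹`.)  So the two-sided use of `hJ` in the landed proof (`exists_mul_lift_mul_eq`)
  is necessary, not an artefact of the proof.
* `stubExpansion_false_without_support` — `stub_expansion` with its support hypothesis
  `hp : ∀ i, ¬ p i → φ(f̌)ᵢ = 0` DROPPED is false: `p ≡ False` makes the index type empty, so
  `repFun = ⊥` (`repFun_eq_bot_of_isEmpty`), while `f = 1 ≠ 0` (`G = Z/2`).

Helpers of independent use: `coeff_invLift` (`f̌.coeff a = f a⁻¹`), `invLift_ne_zero`
(`f ≠ 0 → f̌ ≠ 0`), `exists_block_ne_zero` (a non-zero element of `ℂ[G]` has a non-zero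
Wedderburn block), `character_blockRep_mem_irrChars`.
-/

noncomputable section

set_option linter.dupNamespace false

open scoped BigOperators
open Literature.RepresentationTheory.FiniteGroups Literature.Computability.AlgebraicComplexity

namespace Summit.MatrixMultiplication.MatrixMultiplication.Theorems.GradedPricing.Negative

/-! ## Helpers: the inversion-twisted lift `f̌ = ∑ g, single g (f g⁻¹)` -/

section Helpers

variable {G : Type} [Group G] {r : ℕ} {d : Fin r → ℕ}

/-- Coefficients of the lift: `f̌.coeff a = f a⁻¹`. [folklore] -/
theorem coeff_invLift [Fintype G] (f : G → ℂ) (a : G) :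
    (∑ g : G, MonoidAlgebra.single g (f g⁻¹)).coeff a = f a⁻¹ := by
  classical
  simp only [MonoidAlgebra.coeff_sum, MonoidAlgebra.coeff_single, Finset.sum_apply',
    Finsupp.single_apply]
  rw [Finset.sum_eq_single a]
  · rw [if_pos rfl]
  · intro b _ hb
    rw [if_neg hb]
  · intro h
    exact absurd (Finset.mem_univ a) h

/-- The lift is injective: `f ≠ 0 → f̌ ≠ 0`. [folklore] -/
theorem invLift_ne_zero [Fintype G] {f : G → ℂ} (hf : f ≠ 0) :
    (∑ g : G, MonoidAlgebra.single g (f g⁻¹)) ≠ 0 := by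
  obtain ⟨a, ha⟩ := Function.ne_iff.mp hf
  intro h
  have h1 := congrArg (fun x : MonoidAlgebra ℂ G => x.coeff a⁻¹) h
  simp only [coeff_invLift, inv_inv, MonoidAlgebra.coeff_zero, Finsupp.coe_zero,
    Pi.zero_apply] at h1
  exact ha h1

/-- A non-zero element of `ℂ[G]` has a non-zero Wedderburn block. [folklore] -/
theorem exists_block_ne_zero (φ : MonoidAlgebra ℂ G ≃ₐ[ℂ] BlockAlgebraC d)
    {x : MonoidAlgebra ℂ G} (hx : x ≠ 0) : ∃ i, φ x i ≠ 0 := by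
  by_contra h
  push Not at h
  exact hx (φ.injective (by rw [map_zero]; exact funext h))

/-- The block characters are irreducible characters. [folklore] -/
theorem character_blockRep_mem_irrChars [Finite G] [∀ i, NeZero (d i)]
    (φ : MonoidAlgebra ℂ G ≃ₐ[ℂ] BlockAlgebraC d) (i : Fin r) :
    (blockRep φ i).character ∈ irrChars G :=
  ⟨Fin (d i) → ℂ, inferInstance, inferInstance, inferInstance, blockRep φ i,
    isIrreducible_blockRep φ i, rfl⟩

/-- Over an empty index family, `repFun = ⊥`. [folklore] -/
theorem repFun_eq_bot_of_isEmpty {ι : Type*} [IsEmpty ι] (n : ι → ℕ)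
    (ρ : ∀ i, G →* Matrix.GeneralLinearGroup (Fin (n i)) ℂ) : repFun n ρ = ⊥ := by
  rw [repFun, Submodule.span_eq_bot]
  rintro ψ ⟨i, -⟩
  exact isEmptyElim i

end Helpers

/-! ## `stub_support`: bi-invariance cannot be dropped -/

/-- **Bi-invariance is load-bearing for `stub_support`**: the stub with its hypothesis
`hJ : ∀ f ∈ J, ∀ a b, (fun g => f (a * g * b)) ∈ J` DROPPED (everything else verbatim) is
FALSE (`G = Z/2`, `J = ℂ·δ_g`, `f = δ_g`, `g ≠ 1`). [folklore] -/
theorem stubSupport_false_without_biInv :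
    ¬ ∀ (G : Type) [Group G] [Fintype G] (r : ℕ) (d : Fin r → ℕ) [∀ i, NeZero (d i)]
        (φ : MonoidAlgebra ℂ G ≃ₐ[ℂ] BlockAlgebraC d) (J : Submodule ℂ (G → ℂ))
        (f : G → ℂ), f ∈ J → ∀ i : Fin r,
        φ (∑ g : G, MonoidAlgebra.single g (f g⁻¹)) i ≠ 0 → (blockRep φ i).character ∈ J := by
  intro h
  obtain ⟨r, d, hd, ⟨φ⟩⟩ := exists_algEquiv_pi_matrix (Multiplicative (ZMod 2))
  haveI := hd
  have hδ : (Pi.single (Multiplicative.ofAdd (1 : ZMod 2)) (1 : ℂ) : Multiplicative (ZMod 2) → ℂ) ∈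
      Submodule.span ℂ {(Pi.single (Multiplicative.ofAdd (1 : ZMod 2)) (1 : ℂ) :
        Multiplicative (ZMod 2) → ℂ)} :=
    Submodule.subset_span rfl
  have hne : (Pi.single (Multiplicative.ofAdd (1 : ZMod 2)) (1 : ℂ) : Multiplicative (ZMod 2) → ℂ)
      ≠ 0 := fun h0 => by
    have h1 := congrFun h0 (Multiplicative.ofAdd (1 : ZMod 2))
    rw [Pi.single_eq_same, Pi.zero_apply] at h1
    exact one_ne_zero h1
  obtain ⟨i, hi⟩ := exists_block_ne_zero φ (invLift_ne_zero hne)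
  have hmem := h (Multiplicative (ZMod 2)) r d φ _ _ hδ i hi
  have hboth : (blockRep φ i).character ∈ irrChars (Multiplicative (ZMod 2)) ∩
      ((Submodule.span ℂ {(Pi.single (Multiplicative.ofAdd (1 : ZMod 2)) (1 : ℂ) :
        Multiplicative (ZMod 2) → ℂ)} : Submodule ℂ (Multiplicative (ZMod 2) → ℂ)) :
        Set (Multiplicative (ZMod 2) → ℂ)) :=
    ⟨character_blockRep_mem_irrChars φ i, hmem⟩
  rw [irrChars_inter_span_single ofAdd_one_ne_one] at hboth
  exact hboth

/-! ## `stub_support`: one-sided invariance does not suffice -/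

/-- **Left-invariance alone does not give `stub_support`**: the stub with bi-invariance
WEAKENED to left-invariance `∀ f ∈ J, ∀ a, (fun g => f (a * g)) ∈ J` (everything else verbatim)
is FALSE (`G = S₃`, `J = J_col` the column space of the 2-dimensional irrep, `f = f₁`): the
two-sided use of `hJ` in the landed proof is necessary. [folklore] -/
theorem stubSupport_false_with_leftInv_only :
    ¬ ∀ (G : Type) [Group G] [Fintype G] (r : ℕ) (d : Fin r → ℕ) [∀ i, NeZero (d i)]
        (φ : MonoidAlgebra ℂ G ≃ₐ[ℂ] BlockAlgebraC d) (J : Submodule ℂ (G → ℂ)),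
        (∀ f ∈ J, ∀ a : G, (fun g : G => f (a * g)) ∈ J) →
        ∀ (f : G → ℂ), f ∈ J → ∀ i : Fin r,
        φ (∑ g : G, MonoidAlgebra.single g (f g⁻¹)) i ≠ 0 → (blockRep φ i).character ∈ J := by
  intro h
  obtain ⟨r, d, hd, ⟨φ⟩⟩ := exists_algEquiv_pi_matrix S₃
  haveI := hd
  have hf₁ : f₁ ∈ Jcol := Submodule.subset_span (Set.mem_insert _ _)
  have hne : f₁ ≠ 0 := fun h0 => by
    have h1 := congrFun h0 1
    rw [Pi.zero_apply] at h1
    simp [f₁, table_facts.1] at h1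
  obtain ⟨i, hi⟩ := exists_block_ne_zero φ (invLift_ne_zero hne)
  have hmem := h S₃ r d φ Jcol leftInvariant_Jcol f₁ hf₁ i hi
  have hboth : (blockRep φ i).character ∈ irrChars S₃ ∩ (Jcol : Set (S₃ → ℂ)) :=
    ⟨character_blockRep_mem_irrChars φ i, hmem⟩
  rw [irrChars_inter_Jcol] at hboth
  exact hboth

/-! ## `stub_expansion`: the support hypothesis cannot be dropped -/

/-- **The support hypothesis of `stub_expansion` is load-bearing**: the stub with
`hp : ∀ i, ¬ p i → φ(f̌)ᵢ = 0` DROPPED (conclusion verbatim) is FALSE — with `p ≡ False` the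
index type is empty and `repFun = ⊥`, but `f = 1 ≠ 0` (`G = Z/2`). [folklore] -/
theorem stubExpansion_false_without_support :
    ¬ ∀ (G : Type) [Group G] [Fintype G] (r : ℕ) (d : Fin r → ℕ)
        (φ : MonoidAlgebra ℂ G ≃ₐ[ℂ] BlockAlgebraC d) (p : Fin r → Prop) (f : G → ℂ),
        f ∈ repFun (fun i : {i : Fin r // p i} => d i.1)
          (fun i => ((((Pi.evalAlgHom ℂ (fun j : Fin r => Matrix (Fin (d j)) (Fin (d j)) ℂ) i.1).comp
            φ.toAlgHom).toMonoidHom).comp (MonoidAlgebra.of ℂ G)).toHomUnits) := by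
  intro h
  obtain ⟨r, d, -, ⟨φ⟩⟩ := exists_algEquiv_pi_matrix (Multiplicative (ZMod 2))
  have hmem := h (Multiplicative (ZMod 2)) r d φ (fun _ => False) 1
  haveI : IsEmpty {i : Fin r // False} := ⟨fun i => i.2⟩
  rw [repFun_eq_bot_of_isEmpty, Submodule.mem_bot] at hmem
  exact one_ne_zero hmem

end Summit.MatrixMultiplication.MatrixMultiplication.Theorems.GradedPricing.Negative

end
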